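import Mathlib.LinearAlgebra.Matrix.ToLinearEquiv
import Mathlib.LinearAlgebra.Matrix.Determinant.Basic
import Mathlib.LinearAlgebra.FiniteDimensional.Lemmas
import Mathlib.LinearAlgebra.Dimension.Constructions
import HarnessLib

/-!
# The semilinear kernel trick, cyclic of any order: a singular `σ`-twisted matrix produces a norm of degree `n`

COR-CM (cell `pub-hodgecm2`), binder seat b04 (gen 26), count-neutral claim CYCLIC-SEMIDIRECT-RESIDUE, part Q-Ia′ — the order-`n`
form of `CorCM/SemilinearKernelNorm` (`n = 4`), groundwork for the `2^j`-sheet programme (Galois groups `C_p ⋊_{2^j} C_{2^m}`).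
KERNEL ONLY: theorems; no definition, no named fact, no `sorry`.  `HC_CM` is neither used nor claimed.

THE TRICK.  `L` a field, `σ : L →+* L` with `σ^n = id` ON `L`, `M, P, P' ∈ M_ι(L)` with `M P = P' σ(M)`, and the twisted powers
`Q_0 = 1`, `Q_{k+1} = P σ(Q_k)` (so `Q_k = P σ(P) ⋯ σ^{k-1}(P)`) with `Q_n = a · 1`.  Then `f(v) = P σ(v)` is a `σ`-semilinear
endomorphism of `K = ker M` with `f^n = a`; if `det M = 0 ≠ M` then `d = dim K ∈ [1, #ι)` and the matrix `B` of `f` in a basis of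
`K` has `B σ(B) ⋯ σ^{n−1}(B) = a · 1`, so `z = det B` satisfies `∏_{k<n} σ^k(z) = a^d`.

* `map_iterate_comp_vec`, `twist_iterate` — `[f^k v] = Q_k σ^k(v)`.
* **`exists_norm_eq_pow_of_det_eq_zero_cyclic`** — the trick.

## References

* [Pierce1982] R. S. Pierce, *Associative Algebras*, GTM 88, Springer 1982, §15.1 (cyclic algebras; the norm criterion) —
  replaced here by linear algebra.
-/

open Matrix

namespace Summit.HodgeConjecture.CorCM.SemilinearKernel

variable {L : Type*} [Field L] {ι : Type*} [Fintype ι] [DecidableEq ι]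

omit [DecidableEq ι] in
/-- `σ^k ∘ (N v) = σ^k(N) (σ^k ∘ v)`. [folklore] -/
theorem map_iterate_comp_vec (σ : L →+* L) (k : ℕ) (N : Matrix ι ι L) (w : ι → L) :
    σ^[k] ∘ (N *ᵥ w) = N.map (σ^[k]) *ᵥ (σ^[k] ∘ w) := by
  funext i
  rw [← RingHom.coe_pow]
  exact RingHom.map_mulVec (σ ^ k) N w i

/-- **The twisted powers**: with `Q_0 = 1`, `Q_{k+1} = P σ(Q_k)`, the `k`-th iterate of `v ↦ P σ(v)` is `v ↦ Q_k σ^k(v)`.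
[folklore] -/
theorem twist_iterate (σ : L →+* L) (P : Matrix ι ι L) (Q : ℕ → Matrix ι ι L) (hQ0 : Q 0 = 1)
    (hQs : ∀ k, Q (k + 1) = P * (Q k).map σ) (k : ℕ) (v : ι → L) :
    (fun w : ι → L => P *ᵥ (σ ∘ w))^[k] v = Q k *ᵥ (σ^[k] ∘ v) := by
  induction k generalizing v with
  | zero => simp [hQ0]
  | succ k ih =>
    rw [Function.iterate_succ_apply', ih, hQs, ← mulVec_mulVec]
    congr 1
    funext i
    rw [Function.comp_apply, RingHom.map_mulVec, mulVec, mulVec]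
    refine Finset.sum_congr rfl fun j _ => ?_
    simp only [Matrix.map_apply, Function.comp_apply, Function.iterate_succ_apply']

/-- **THE SEMILINEAR KERNEL TRICK, cyclic of order `n`.**  `σ^n = id`, `M P = P' σ(M)`, `Q_0 = 1`, `Q_{k+1} = P σ(Q_k)`,
`Q_n = a · 1`, `det M = 0`, `M ≠ 0` ⟹ `∃ d`, `1 ≤ d < #ι`, `∃ z`, `∏_{k<n} σ^k(z) = a^d`. [cite: Pierce1982, §15.1] -/
theorem exists_norm_eq_pow_of_det_eq_zero_cyclic (σ : L →+* L) (n : ℕ) (hσn : ∀ x, σ^[n] x = x)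
    (M P P' : Matrix ι ι L) (a : L) (hM : M * P = P' * M.map σ) (Q : ℕ → Matrix ι ι L) (hQ0 : Q 0 = 1)
    (hQs : ∀ k, Q (k + 1) = P * (Q k).map σ) (hQn : Q n = a • (1 : Matrix ι ι L)) (hdet : M.det = 0) (hM0 : M ≠ 0) :
    ∃ d : ℕ, 1 ≤ d ∧ d < Fintype.card ι ∧ ∃ z : L, ∏ k ∈ Finset.range n, σ^[k] z = a ^ d := by
  classical
  -- the kernel and the semilinear operator on it
  set K : Submodule L (ι → L) := LinearMap.ker (Matrix.toLin' M) with hK_def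
  have hmemK : ∀ v : ι → L, v ∈ K ↔ M *ᵥ v = 0 := fun v => by
    rw [hK_def, LinearMap.mem_ker, Matrix.toLin'_apply]
  have hfK : ∀ v : K, P *ᵥ (σ ∘ (v : ι → L)) ∈ K := fun v => by
    refine (hmemK _).2 ?_
    rw [mulVec_mulVec, hM, ← mulVec_mulVec]
    have h1 : M.map σ *ᵥ (σ ∘ (v : ι → L)) = σ ∘ (M *ᵥ (v : ι → L)) := by
      funext i; exact (RingHom.map_mulVec σ M _ i).symm
    rw [h1, (hmemK _).1 v.2]
    have : σ ∘ (0 : ι → L) = 0 := by funext i; simp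
    rw [this, mulVec_zero]
  set f : K → K := fun v => ⟨P *ᵥ (σ ∘ (v : ι → L)), hfK v⟩ with hf_def
  have hf_coe : ∀ v : K, ((f v : K) : ι → L) = P *ᵥ (σ ∘ (v : ι → L)) := fun v => rfl
  have hf_add : ∀ v w : K, f (v + w) = f v + f w := fun v w => by
    apply Subtype.ext
    simp only [hf_coe, Submodule.coe_add]
    rw [← mulVec_add]
    congr 1
    funext i; simp
  have hf_smul : ∀ (c : L) (v : K), f (c • v) = σ c • f v := fun c v => by
    apply Subtype.ext
    simp only [hf_coe, Submodule.coe_smul]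
    rw [← mulVec_smul]
    congr 1
    funext i; simp
  have hfk_coe : ∀ (k : ℕ) (v : K), ((f^[k] v : K) : ι → L) = (fun w : ι → L => P *ᵥ (σ ∘ w))^[k] (v : ι → L) := by
    intro k
    induction k with
    | zero => intro v; rfl
    | succ k ih => intro v; rw [Function.iterate_succ_apply', Function.iterate_succ_apply', hf_coe, ih]
  have hfn : ∀ v : K, f^[n] v = a • v := fun v => by
    apply Subtype.ext
    rw [hfk_coe, twist_iterate σ P Q hQ0 hQs, hQn, Submodule.coe_smul, Matrix.smul_mulVec, one_mulVec]
    congr 1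
    funext i; exact hσn _
  -- dimension of the kernel
  set d := Module.finrank L K with hd_def
  have hd1 : 1 ≤ d := by
    obtain ⟨v, hv0, hv⟩ := (Matrix.exists_mulVec_eq_zero_iff (M := M)).2 hdet
    have hvK : v ∈ K := (hmemK v).2 hv
    by_contra h
    have h0 : d = 0 := by omega
    rw [hd_def, Submodule.finrank_eq_zero] at h0
    rw [h0] at hvK
    exact hv0 ((Submodule.mem_bot L).1 hvK)
  have hdlt : d < Fintype.card ι := by
    have hlt : K < ⊤ := by
      refine lt_top_iff_ne_top.2 fun htop => hM0 ?_
      ext i j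
      have hj : (Pi.single j (1 : L) : ι → L) ∈ K := by rw [htop]; exact Submodule.mem_top
      have h := congrFun ((hmemK _).1 hj) i
      simpa [Matrix.mulVec_single_one] using h
    have h := Submodule.finrank_lt_finrank_of_lt hlt
    rwa [finrank_top, Module.finrank_fintype_fun_eq_card] at h
  -- a basis of the kernel and the matrix of `f`
  set b := Module.finBasis L K with hb_def
  set B : Matrix (Fin d) (Fin d) L := fun l k => b.equivFun (f (b k)) l with hB_def
  -- coordinates: `[f w] = B σ([w])`
  have hcoord : ∀ w : K, b.equivFun (f w) = B *ᵥ (σ ∘ b.equivFun w) := fun w => by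
    have hw : w = ∑ k, b.equivFun w k • b k := (b.sum_equivFun w).symm
    have hfw : f w = ∑ k, σ (b.equivFun w k) • f (b k) := by
      conv_lhs => rw [hw]
      have : ∀ (s : Finset (Fin d)), f (∑ k ∈ s, b.equivFun w k • b k) = ∑ k ∈ s, σ (b.equivFun w k) • f (b k) := by
        intro s
        induction s using Finset.induction_on with
        | empty =>
          apply Subtype.ext
          simp only [Finset.sum_empty, hf_coe, Submodule.coe_zero]
          have : σ ∘ (0 : ι → L) = 0 := by funext i; simp
          rw [this, mulVec_zero]
        | insert k s hk ih => rw [Finset.sum_insert hk, Finset.sum_insert hk, hf_add, hf_smul, ih]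
      exact this _
    rw [hfw, map_sum]
    funext l
    simp only [map_smul, Finset.sum_apply, Pi.smul_apply, smul_eq_mul, mulVec, dotProduct, Function.comp_apply, hB_def]
    exact Finset.sum_congr rfl fun k _ => mul_comm _ _
  -- the twisted powers of `B`: `BQ_0 = 1`, `BQ_{k+1} = B σ(BQ_k)`; `[f^k w] = BQ_k σ^k([w])`
  have hiter : ∀ (k : ℕ) (w : K), b.equivFun (f^[k] w) =
      (Nat.rec (1 : Matrix (Fin d) (Fin d) L) (fun _ R => B * R.map σ) k) *ᵥ (σ^[k] ∘ b.equivFun w) := by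
    intro k
    induction k with
    | zero => intro w; simp
    | succ k ih =>
      intro w
      rw [Function.iterate_succ_apply', hcoord, ih, ← mulVec_mulVec]
      congr 1
      funext i
      rw [Function.comp_apply, RingHom.map_mulVec, mulVec, mulVec]
      refine Finset.sum_congr rfl fun j _ => ?_
      simp only [Matrix.map_apply, Function.comp_apply, Function.iterate_succ_apply']
  set BQ : ℕ → Matrix (Fin d) (Fin d) L := fun k => Nat.rec (1 : Matrix (Fin d) (Fin d) L) (fun _ R => B * R.map σ) k
    with hBQ_def
  have hBQ0 : BQ 0 = 1 := rfl
  have hBQs : ∀ k, BQ (k + 1) = B * (BQ k).map σ := fun k => rfl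
  have hBQn : BQ n = a • (1 : Matrix (Fin d) (Fin d) L) := by
    refine Matrix.toLin'.injective (LinearMap.ext fun c => ?_)
    rw [Matrix.toLin'_apply, Matrix.toLin'_apply, Matrix.smul_mulVec, one_mulVec]
    obtain ⟨w, rfl⟩ : ∃ w : K, b.equivFun w = c := ⟨b.equivFun.symm c, b.equivFun.apply_symm_apply c⟩
    have h := hiter n w
    rw [hfn, map_smul] at h
    have hv : σ^[n] ∘ b.equivFun w = b.equivFun w := by funext i; exact hσn _
    rw [hv] at h
    exact h.symm
  -- determinants: `det BQ_k = ∏_{i<k} σ^i(det B)`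
  have hdetBQ : ∀ k, (BQ k).det = ∏ i ∈ Finset.range k, σ^[i] B.det := by
    intro k
    induction k with
    | zero => rw [hBQ0, det_one, Finset.prod_range_zero]
    | succ k ih =>
      rw [hBQs, det_mul, ← RingHom.mapMatrix_apply, ← RingHom.map_det, ih, map_prod, Finset.prod_range_succ', mul_comm]
      congr 1
      refine Finset.prod_congr rfl fun i _ => ?_
      rw [Function.iterate_succ_apply']
  refine ⟨d, hd1, hdlt, B.det, ?_⟩
  rw [← hdetBQ n, hBQn, det_smul, det_one, mul_one, Fintype.card_fin]

end Summit.HodgeConjecture.CorCM.SemilinearKernel
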